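import Literature.AlgebraicGeometry.Motives.MumfordTateRankTwo
import Literature.AlgebraicGeometry.Motives.ZarhinHodgeGroupLieAlgebra
import HarnessLib

/-!
# Weights of `ad Θ` on the complexified Mumford–Tate Lie algebra: matrix entries in a graded basis, the
# conjugation symmetry `k ↔ −k`, Lie closure, and `dim_ℂ 𝔪𝔱_ℂ ≤ dim_ℚ 𝔪𝔱`

Family `hodge`, layer `Literature/AlgebraicGeometry/Motives`; THEOREMS ONLY (no definition, no named fact;
D-0026).  Linear-algebra preliminaries of `Motives/MumfordTateRankThree` («`dim MT(H) ≤ 3` ⟹ `𝔪𝔱 ⊆ End_Hdg(V)`»),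
written for the cell `pub-hodgecm2` (COR-CM) lane MT-RANK-THREE.

Let `H` be a pure `ℚ`-Hodge structure of weight `n` on a finite-dimensional `V`, `𝔪𝔱 = H.mumfordTateLieAlgebra`
(`= H.lieStabilizer`, the annihilator of the weight-`0` Hodge tensors; `dim_ℚ 𝔪𝔱 = H.mtRank = dim MT(H)`),
`End_Hdg(V) = H.endAlg`, `e` a graded basis of `V_ℂ` adapted to `H` with degrees `deg`
(`exists_basis_F_eq_span`), `Θ = gradingEnd e deg` the grading operator (`Θ = p` on `V^{p,q}`), and
`𝔪𝔱_ℂ = span_ℂ {X_ℂ | X ∈ 𝔪𝔱} ⊆ End_ℂ V_ℂ`.  For `Y ∈ End_ℂ V_ℂ` write `Y_{στ}` for the `σ`-coordinate of `Y (e τ)`.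

* §1 `repr_gradingEnd_apply`, `repr_commutator_gradingEnd_apply_basis` — `[Θ, Y]_{στ} = (deg σ − deg τ) · Y_{στ}`:
  the entry `Y_{στ}` is a root component of `Y` of WEIGHT `deg σ − deg τ` for `ad Θ`.
* §2 `mem_endAlg_of_repr_baseChange_eq_zero` — an `x ∈ End_ℚ V` all of whose entries of non-zero weight vanish
  is a Hodge endomorphism.
* §3 `conj_basis_mem_span_of_graded`, `complexConj_span_image_eq`, `repr_baseChange_apply_eq_zero_of_neg` —
  **complex conjugation exchanges the weights `k` and `−k`**: for a RATIONAL `x`, if all entries of `x_ℂ` of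
  weight `−k` vanish then so do all entries of weight `k` (`x_ℂ` commutes with `conj`, which maps `V^{p,q}` onto
  `V^{q,p}`).
* §4 `commutator_mem_mumfordTateLieAlgebra`, `commutator_mem_span_baseChange_mumfordTateLieAlgebra`,
  `finrank_span_baseChange_le_mtRank` — `𝔪𝔱` and `𝔪𝔱_ℂ` are Lie algebras (the derivation action is a Lie
  homomorphism, `tensorDerivation_commutator_apply_eq_zero`; cf. `commutator_mem_hodgeLie` for `Lie Hdg`), and
  `dim_ℂ 𝔪𝔱_ℂ ≤ dim_ℚ 𝔪𝔱` (the complexifications of a `ℚ`-basis span).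

## References

* [Deligne1982HodgeCycles] P. Deligne, *Hodge cycles on abelian varieties*, LNM 900 (1982), I §3, Prop. 3.4 (and
  its proof: `μ(𝔾ₘ) ⊆ MT_ℂ`), Ex. 3.7.
* [DeligneHodgeII1971] P. Deligne, *Théorie de Hodge II*, Publ. Math. IHÉS 40 (1971), 1.2.5, 2.1.4 (the real
  structure and `conj V^{p,q} = V^{q,p}`).
* [GreenGriffithsKerr2012] M. Green, P. Griffiths, M. Kerr, *Mumford–Tate Groups and Domains* (2012), I.B
  (I.B.1)–(I.B.5).
* [Huybrechts2016K3] D. Huybrechts, *Lectures on K3 Surfaces* (2016), §3.3.3–3.3.4 (`End_Hdg`).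
* A. Borel, *Linear Algebraic Groups*, 2nd ed. (1991), §3.9, §8.17 (weights of a diagonal torus on `𝔤𝔩`).
-/

noncomputable section

open scoped TensorProduct

namespace Literature.AlgebraicGeometry.Motives

universe u v

/-! ## §1 Matrix entries of the grading operator and of `ad Θ` in a graded basis -/

section Entries

variable {W : Type u} [AddCommGroup W] [Module ℂ W] {S : Type v} [Fintype S] [DecidableEq S]

/-- The grading operator is diagonal: the `σ`-coordinate of `Θ w` is `deg σ` times the `σ`-coordinate of `w`
(Deligne I §3: `μ(λ)` acts on `V^{p,q}` by a scalar, so `dμ(1) = Θ` is diagonal in every graded basis).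
[cite: Deligne1982HodgeCycles, I §3 (proof of Prop. 3.4)] -/
theorem repr_gradingEnd_apply (e : Module.Basis S ℂ W) (deg : S → ℤ) (w : W) (σ : S) :
    e.repr (gradingEnd e deg w) σ = (deg σ : ℂ) * e.repr w σ := by
  have h : (e.coord σ).comp (gradingEnd e deg) = (deg σ : ℂ) • e.coord σ := by
    refine e.ext fun τ => ?_
    simp only [LinearMap.comp_apply, gradingEnd_apply_basis, map_smul, LinearMap.smul_apply,
      Module.Basis.coord_apply, Module.Basis.repr_self, smul_eq_mul, Finsupp.single_apply]
    by_cases hτσ : τ = σ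
    · subst hτσ; simp
    · simp [hτσ]
  have h' := LinearMap.congr_fun h w
  simpa only [LinearMap.comp_apply, Module.Basis.coord_apply, LinearMap.smul_apply, smul_eq_mul] using h'

/-- **Entries of a commutator with the grading operator**: in a graded basis,
`[Θ, Y]_{στ} = (deg σ − deg τ) · Y_{στ}` — the `(σ, τ)`-entry of `Y` is a root component of weight
`deg σ − deg τ` for `ad Θ` (Borel, *Linear Algebraic Groups*, §8.17: the diagonal torus of `GL_n` acts on the
elementary matrix `E_{στ}` through the character `t_σ t_τ⁻¹`, infinitesimally `deg σ − deg τ`). [cite: Borel1991, §8.17] -/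
theorem repr_commutator_gradingEnd_apply_basis (e : Module.Basis S ℂ W) (deg : S → ℤ) (Y : Module.End ℂ W)
    (σ τ : S) :
    e.repr ((gradingEnd e deg * Y - Y * gradingEnd e deg) (e τ)) σ =
      ((deg σ : ℂ) - deg τ) * e.repr (Y (e τ)) σ := by
  simp only [LinearMap.sub_apply, Module.End.mul_apply, gradingEnd_apply_basis, map_sub, map_smul,
    Finsupp.coe_sub, Pi.sub_apply, Finsupp.coe_smul, Pi.smul_apply, smul_eq_mul, repr_gradingEnd_apply]
  ring

end Entries

namespace HodgeStructure

variable {V : Type u} [AddCommGroup V] [Module ℚ V] [Module.Finite ℚ V] [HodgeTensorFacts.{u, u}] {n : ℤ}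
  {S : Type u} [Fintype S] [DecidableEq S] {deg : S → ℤ}

/-! ## §2 An operator all of whose entries of non-zero weight vanish is a Hodge endomorphism -/

omit [Module.Finite ℚ V] [HodgeTensorFacts.{u, u}] [Fintype S] [DecidableEq S] in
/-- **Weight-`0` operators are Hodge endomorphisms.**  If every entry `(x_ℂ)_{στ}` with `deg σ ≠ deg τ` vanishes
(in a graded basis adapted to `H`), then `x_ℂ (e τ) ∈ span {e σ | deg σ = deg τ} ⊆ F^{p}` for `p ≤ deg τ`, so
`x_ℂ` preserves the Hodge filtration: `x ∈ End_Hdg(V)`. [cite: Huybrechts2016K3, §3.3.3] -/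
theorem mem_endAlg_of_repr_baseChange_eq_zero (H : HodgeStructure V n) (e : Module.Basis S ℂ (ℂ ⊗[ℚ] V))
    (hF : ∀ a, H.F a = Submodule.span ℂ (e '' {σ | a ≤ deg σ})) {x : Module.End ℚ V}
    (hx : ∀ σ τ, deg σ ≠ deg τ → e.repr (x.baseChange ℂ (e τ)) σ = 0) : x ∈ H.endAlg := by
  have hcol : ∀ τ, x.baseChange ℂ (e τ) ∈ Submodule.span ℂ (e '' {σ | deg σ = deg τ}) := by
    intro τ
    rw [Module.Basis.mem_span_image]
    intro σ hσ
    by_contra hne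
    exact (Finsupp.mem_support_iff.1 hσ) (hx σ τ hne)
  rw [mem_endAlg_iff]
  intro p
  rw [hF p, Submodule.map_span_le]
  rintro _ ⟨τ, hτ, rfl⟩
  refine Submodule.span_mono (Set.image_mono fun σ hσ => ?_) (hcol τ)
  simp only [Set.mem_setOf_eq] at hσ hτ ⊢
  omega

/-! ## §3 Complex conjugation exchanges the weights `k` and `−k` -/

omit [Module.Finite ℚ V] [HodgeTensorFacts.{u, u}] [Fintype S] [DecidableEq S] in
/-- In a graded basis adapted to `H`, the conjugate of a basis vector of degree `p` lies in the span of the basis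
vectors of degree `n − p` (`conj V^{p,n-p} = V^{n-p,p}`). [cite: VoisinHodgeI2002, §7.1.1 Def. 7.4] -/
theorem conj_basis_mem_span_of_graded (H : HodgeStructure V n) (e : Module.Basis S ℂ (ℂ ⊗[ℚ] V))
    (hF : ∀ a, H.F a = Submodule.span ℂ (e '' {σ | a ≤ deg σ}))
    (hFc : ∀ a, complexConj (H.F a) = Submodule.span ℂ (e '' {σ | deg σ ≤ n - a})) (σ : S) :
    conj (e σ) ∈ Submodule.span ℂ (e '' {ρ | deg ρ = n - deg σ}) := by
  have h1 : conj (e σ) ∈ H.piece (n - deg σ) (deg σ) := conj_mem_piece H (basis_mem_piece_of_graded H e hF hFc σ)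
  have h2 : H.piece (n - deg σ) (deg σ) = Submodule.span ℂ (e '' {ρ | deg ρ = n - deg σ}) := by
    have h := piece_eq_span_of_graded H e hF hFc (n - deg σ)
    rwa [sub_sub_cancel] at h
  rwa [h2] at h1

omit [Module.Finite ℚ V] [HodgeTensorFacts.{u, u}] [Fintype S] [DecidableEq S] in
/-- **Conjugation reflects the degrees**: for any condition `P` on degrees, the complex conjugate of
`span {e σ | P (deg σ)}` is `span {e σ | P (n − deg σ)}` (both are sums of Hodge pieces, and
`conj V^{p,n-p} = V^{n-p,p}`). [cite: DeligneHodgeII1971, 1.2.5] -/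
theorem complexConj_span_image_eq (H : HodgeStructure V n) (e : Module.Basis S ℂ (ℂ ⊗[ℚ] V))
    (hF : ∀ a, H.F a = Submodule.span ℂ (e '' {σ | a ≤ deg σ}))
    (hFc : ∀ a, complexConj (H.F a) = Submodule.span ℂ (e '' {σ | deg σ ≤ n - a})) (P : ℤ → Prop) :
    complexConj (Submodule.span ℂ (e '' {σ | P (deg σ)})) = Submodule.span ℂ (e '' {σ | P (n - deg σ)}) := by
  have key : ∀ Q : ℤ → Prop, Submodule.span ℂ (e '' {σ | Q (n - deg σ)}) ≤
      complexConj (Submodule.span ℂ (e '' {σ | Q (deg σ)})) := by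
    intro Q
    rw [Submodule.span_le]
    rintro _ ⟨σ, hσ, rfl⟩
    rw [SetLike.mem_coe, mem_complexConj]
    refine Submodule.span_mono (Set.image_mono fun ρ hρ => ?_) (conj_basis_mem_span_of_graded H e hF hFc σ)
    simp only [Set.mem_setOf_eq] at hρ hσ ⊢
    rw [hρ]
    exact hσ
  apply le_antisymm
  · have h := complexConj_mono (key fun d => P (n - d))
    simp only [sub_sub_cancel, complexConj_complexConj] at h
    exact h
  · exact key P

omit [Module.Finite ℚ V] [HodgeTensorFacts.{u, u}] [Fintype S] [DecidableEq S] in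
/-- **For a RATIONAL `x`, if all entries of `x_ℂ` of weight `−k` vanish then so do all entries of weight `k`.**
Indeed `x_ℂ` commutes with `conj` (`conj_baseChange`): `x_ℂ (e τ) = conj (x_ℂ (conj (e τ)))`, `conj (e τ)` lies in
the span of the basis vectors of degree `n − deg τ`, which `x_ℂ` maps (weight `−k` vanishing) into
`span {e σ' | deg σ' ≠ n − deg τ − k}`, whose conjugate is `span {e σ' | deg σ' ≠ deg τ + k}`.
[cite: Deligne1982HodgeCycles, I §3 (proof of Prop. 3.4)] [cite: DeligneHodgeII1971, 1.2.5] -/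
theorem repr_baseChange_apply_eq_zero_of_neg (H : HodgeStructure V n) (e : Module.Basis S ℂ (ℂ ⊗[ℚ] V))
    (hF : ∀ a, H.F a = Submodule.span ℂ (e '' {σ | a ≤ deg σ}))
    (hFc : ∀ a, complexConj (H.F a) = Submodule.span ℂ (e '' {σ | deg σ ≤ n - a})) (x : Module.End ℚ V)
    {k : ℤ} (h : ∀ σ τ, deg σ - deg τ = -k → e.repr (x.baseChange ℂ (e τ)) σ = 0) (σ τ : S)
    (hk : deg σ - deg τ = k) : e.repr (x.baseChange ℂ (e τ)) σ = 0 := by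
  set Y := x.baseChange ℂ with hY
  -- `Y` maps the basis vectors of degree `n - deg τ` into `span {e σ' | deg σ' ≠ n - deg τ - k}`
  have hU : ∀ ρ, deg ρ = n - deg τ →
      Y (e ρ) ∈ Submodule.span ℂ (e '' {σ' | deg σ' ≠ n - deg τ - k}) := by
    intro ρ hρ
    rw [Module.Basis.mem_span_image]
    intro σ' hσ' hEq
    exact (Finsupp.mem_support_iff.1 hσ') (h σ' ρ (by rw [hρ, hEq]; ring))
  have hYc : Y (conj (e τ)) ∈ Submodule.span ℂ (e '' {σ' | deg σ' ≠ n - deg τ - k}) := by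
    have hmap : (Submodule.span ℂ (e '' {ρ | deg ρ = n - deg τ})).map Y ≤
        Submodule.span ℂ (e '' {σ' | deg σ' ≠ n - deg τ - k}) := by
      rw [Submodule.map_span_le]
      rintro _ ⟨ρ, hρ, rfl⟩
      exact hU ρ hρ
    exact hmap (Submodule.mem_map_of_mem (conj_basis_mem_span_of_graded H e hF hFc τ))
  -- conjugate back
  have hmem : Y (e τ) ∈ complexConj (Submodule.span ℂ (e '' {σ' | deg σ' ≠ n - deg τ - k})) := by
    rw [mem_complexConj, hY, conj_baseChange, ← hY]
    exact hYc
  have hcc := complexConj_span_image_eq H e hF hFc fun d => d ≠ n - deg τ - k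
  rw [hcc, Module.Basis.mem_span_image] at hmem
  by_contra hne
  have hσ : σ ∈ (↑(e.repr (Y (e τ))).support : Set S) := by
    rw [Finset.mem_coe, Finsupp.mem_support_iff]
    exact hne
  have h' := hmem hσ
  simp only [Set.mem_setOf_eq] at h'
  omega

/-! ## §4 `𝔪𝔱` and `𝔪𝔱_ℂ` are Lie algebras; `dim_ℂ 𝔪𝔱_ℂ ≤ dim_ℚ 𝔪𝔱` -/

omit [Fintype S] [DecidableEq S] in
/-- **`𝔪𝔱` is a Lie subalgebra of `𝔤𝔩(V)`**: `XY − YX ∈ 𝔪𝔱` for `X, Y ∈ 𝔪𝔱` (the derivation action on the tensor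
spaces is a Lie algebra homomorphism, `tensorDerivation_commutator_apply_eq_zero`; cf. `commutator_mem_hodgeLie` for
`Lie Hdg`). [cite: Deligne1982HodgeCycles, I Prop. 3.4] -/
theorem commutator_mem_mumfordTateLieAlgebra (H : HodgeStructure V n) {X Y : Module.End ℚ V}
    (hX : X ∈ H.mumfordTateLieAlgebra) (hY : Y ∈ H.mumfordTateLieAlgebra) :
    X * Y - Y * X ∈ H.mumfordTateLieAlgebra := by
  rw [mumfordTateLieAlgebra_eq_lieStabilizer, mem_lieStabilizer_iff] at hX hY ⊢
  intro a b hab t ht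
  exact tensorDerivation_commutator_apply_eq_zero (hX a b hab t ht) (hY a b hab t ht)

omit [Fintype S] [DecidableEq S] in
/-- **`𝔪𝔱_ℂ = span_ℂ {X_ℂ | X ∈ 𝔪𝔱}` is a Lie subalgebra of `𝔤𝔩(V_ℂ)`** (bilinear extension of
`commutator_mem_mumfordTateLieAlgebra`). [cite: Deligne1982HodgeCycles, I Prop. 3.4] -/
theorem commutator_mem_span_baseChange_mumfordTateLieAlgebra (H : HodgeStructure V n)
    {Y Z : Module.End ℂ (ℂ ⊗[ℚ] V)}
    (hY : Y ∈ Submodule.span ℂ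
      ((fun X : Module.End ℚ V => X.baseChange ℂ) '' (H.mumfordTateLieAlgebra : Set (Module.End ℚ V))))
    (hZ : Z ∈ Submodule.span ℂ
      ((fun X : Module.End ℚ V => X.baseChange ℂ) '' (H.mumfordTateLieAlgebra : Set (Module.End ℚ V)))) :
    Y * Z - Z * Y ∈ Submodule.span ℂ
      ((fun X : Module.End ℚ V => X.baseChange ℂ) '' (H.mumfordTateLieAlgebra : Set (Module.End ℚ V))) := by
  induction hY using Submodule.span_induction with
  | mem Y' hY' =>
    obtain ⟨X, hX, rfl⟩ := hY'
    induction hZ using Submodule.span_induction with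
    | mem Z' hZ' =>
      obtain ⟨X', hX', rfl⟩ := hZ'
      refine Submodule.subset_span ⟨X * X' - X' * X, commutator_mem_mumfordTateLieAlgebra H hX hX', ?_⟩
      simp only [LinearMap.baseChange_sub, LinearMap.baseChange_mul]
    | zero => simp
    | add Z₁ Z₂ _ _ h₁ h₂ =>
      rw [mul_add, add_mul, add_sub_add_comm]
      exact Submodule.add_mem _ h₁ h₂
    | smul c Z₁ _ h₁ =>
      rw [mul_smul_comm, smul_mul_assoc, ← smul_sub]
      exact Submodule.smul_mem _ c h₁
  | zero => simp
  | add Y₁ Y₂ _ _ h₁ h₂ =>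
    rw [add_mul, mul_add, add_sub_add_comm]
    exact Submodule.add_mem _ h₁ h₂
  | smul c Y₁ _ h₁ =>
    rw [smul_mul_assoc, mul_smul_comm, ← smul_sub]
    exact Submodule.smul_mem _ c h₁

omit [Fintype S] [DecidableEq S] in
/-- **`dim_ℂ 𝔪𝔱_ℂ ≤ dim_ℚ 𝔪𝔱 = dim MT(H)`**: the complexifications of a `ℚ`-basis of `𝔪𝔱` span `𝔪𝔱_ℂ`.
[cite: BaldiKlinglerUllmo2024, §3.2] -/
theorem finrank_span_baseChange_le_mtRank (H : HodgeStructure V n) :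
    Module.finrank ℂ (Submodule.span ℂ
      ((fun X : Module.End ℚ V => X.baseChange ℂ) '' (H.mumfordTateLieAlgebra : Set (Module.End ℚ V)))) ≤
      H.mtRank := by
  set L := H.mumfordTateLieAlgebra with hL
  let b := Module.finBasis ℚ L
  let f : Fin (Module.finrank ℚ L) → Module.End ℂ (ℂ ⊗[ℚ] V) :=
    fun i => ((b i : L) : Module.End ℚ V).baseChange ℂ
  have hle : Submodule.span ℂ ((fun X : Module.End ℚ V => X.baseChange ℂ) '' (L : Set (Module.End ℚ V))) ≤
      Submodule.span ℂ (Set.range f) := by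
    rw [Submodule.span_le]
    rintro _ ⟨X, hX, rfl⟩
    have hX' : X = ∑ i, (b.repr ⟨X, hX⟩ i) • ((b i : L) : Module.End ℚ V) := by
      have h := congrArg Subtype.val (b.sum_repr ⟨X, hX⟩)
      rw [Submodule.coe_sum] at h
      simpa only [Submodule.coe_smul] using h.symm
    have hbc : ((∑ i, (b.repr ⟨X, hX⟩ i) • ((b i : L) : Module.End ℚ V)).baseChange ℂ :
        Module.End ℂ (ℂ ⊗[ℚ] V)) = ∑ i, (b.repr ⟨X, hX⟩ i) • f i := by
      change LinearMap.baseChangeHom ℚ ℂ V V _ = _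
      rw [map_sum]
      refine Finset.sum_congr rfl fun i _ => ?_
      rw [map_smul, LinearMap.baseChangeHom_apply]
    rw [SetLike.mem_coe]
    change X.baseChange ℂ ∈ _
    rw [hX', hbc]
    exact Submodule.sum_mem _ fun i _ => Submodule.smul_of_tower_mem _ _ (Submodule.subset_span ⟨i, rfl⟩)
  calc Module.finrank ℂ (Submodule.span ℂ
          ((fun X : Module.End ℚ V => X.baseChange ℂ) '' (L : Set (Module.End ℚ V))))
        ≤ Module.finrank ℂ (Submodule.span ℂ (Set.range f)) := Submodule.finrank_mono hle
    _ ≤ Fintype.card (Fin (Module.finrank ℚ L)) := finrank_range_le_card f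
    _ = H.mtRank := by rw [Fintype.card_fin]; rfl

end HodgeStructure

end Literature.AlgebraicGeometry.Motives

end
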